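import Summits.ValiantsHypothesis.ValiantsHypothesis.Theses.FeketeSOS

/-!
# `SOSMagnification` / `FeketeSOSHard` — negative lemmas: the primality of the modulus is load-bearing

Crux `stmt-ValiantsHypothesis-3995` (`FeketeSOS.SOSMagnification`) is literally
`FeketeSOSHard → ValiantsHypothesis`; its hypothesis X = `FeketeSOSHard` says that for some `δ > 0`
and all large PRIMES `p` every weighted-SOS representation `F_p = ∑_{i<s} cᵢ gᵢ²` of the Fekete
polynomial `F_p = ∑_{m<p} (m|p) X^m ∈ ℂ[X]` with `s ≤ p^δ` squares of degree `≤ p²` has support-sum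
`∑ |supp gᵢ| ≥ p^{1/2+δ}`.  This file (standing-disprover findings, cycle 3; work file
`Cruxes/SOSMagnification/Disproof.lean`) records that the hypothesis "`p` prime" cannot be weakened to
"`p` odd" (reading the Legendre symbol as the Jacobi symbol `(m|p)`, which is the same thing at primes —
`jacobi_slice_to_legendre_slice` certifies that the odd-modulus statement implies the prime one):

* `prime_sq_digit_split`: at a prime-square modulus the Jacobi–Fekete polynomial is a product of two
  `q`-sparse polynomials, `F_{q²} = (∑_{1≤a<q} X^a)·(∑_{b<q} X^{qb})` (`(m|q²) = [q ∤ m]` is the principal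
  character; the identity is the interval tiling `[0,q²) ∖ qℕ = [1,q) ⊕ q·[0,q)`);
* `feketeSOSHard_slice_false_without_prime`, `feketeSOSHard_false_without_prime`: hence the odd-modulus
  version of X fails at EVERY `δ > 0` — `F_{q²} = ¼(A+B)² − ¼(A−B)²` has `s = 2` squares of degree `≤ q²`
  and support-sum `≤ 4q − 2 < (q²)^{1/2+δ}`;
* (companion file `FeketeImprimitiveModuli.lean`: the same at EVERY `δ > 0` for NON-PRINCIPAL characters,
  moduli `q^(2j+1)`);
* `prime_cube_digit_split`: the same mechanism for a NON-principal character — for the imprimitive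
  character `(·|q)` modulo `q³`, `F_{q³} = F_q(X)·∑_{j<q²} X^{qj}`, support-sum `O(n^{2/3})` at `n = q³`
  (and `F_{q^{2j+1}} = F_q(X)·∏_{i=1}^{2j} Ψ_q(X^{qⁱ})`, `Ψ_q = ∑_{l<q} X^l`, balanced into two halves, has
  support-sum `≤ 2q^{j+1} = 2n^{1/2+1/(4j+2)}`: for every `δ > 0` there are non-principal odd moduli
  violating the δ-slice).

So the sparse representations of imprimitive characters are exactly the inverse multilinear Kronecker
substitution `X ↦ (X, X^q, X^{q²}, …)` of the magnification step run backwards, and any proof of X must use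
that `χ_p` is primitive of conductor `p`, not merely multiplicative, real and `{0,±1}`-valued.

References: P. Dutta, N. Saxena, T. Thierauf, comput. complexity 33 (2024), Def. 1.1, §3.1
[DuttaSaxenaThierauf2024] (the weighted-SOS model and the Kronecker map); the lemmas are folklore algebra
and elementary number theory (Mathlib `jacobiSym`).
-/

namespace Summit.ValiantsHypothesis.ValiantsHypothesis.Theorems.SOSMagnification.Negative

set_option linter.dupNamespace false

open Polynomial
open scoped BigOperators

/-! ### The digit factors -/

/-- Coefficients of the low-digit factor `∑_{1≤a<q} X^a`. [folklore] -/
theorem coeff_lowDigits (q n : ℕ) :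
    (∑ a ∈ Finset.Ico 1 q, (X : Polynomial ℂ) ^ a).coeff n = if n ∈ Finset.Ico 1 q then (1 : ℂ) else 0 := by
  simp only [finsetSum_coeff, coeff_X_pow]
  rw [Finset.sum_ite_eq]

/-- Support of the low-digit factor. [folklore] -/
theorem support_lowDigits_subset (q : ℕ) :
    (∑ a ∈ Finset.Ico 1 q, (X : Polynomial ℂ) ^ a).support ⊆ Finset.Ico 1 q := by
  intro n hn
  rw [mem_support_iff, coeff_lowDigits] at hn
  by_contra h
  exact hn (if_neg h)

/-- The low-digit factor is `(q−1)`-sparse. [folklore] -/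
theorem card_support_lowDigits_le (q : ℕ) :
    (∑ a ∈ Finset.Ico 1 q, (X : Polynomial ℂ) ^ a).support.card ≤ q - 1 :=
  (Finset.card_le_card (support_lowDigits_subset q)).trans (by simp)

/-- Coefficients of a high-digit factor `∑_{b<r} X^{qb}`. [folklore] -/
theorem coeff_highDigits (q r n : ℕ) :
    (∑ b ∈ Finset.range r, (X : Polynomial ℂ) ^ (q * b)).coeff n =
      ∑ b ∈ Finset.range r, if n = q * b then (1 : ℂ) else 0 := by
  simp only [finsetSum_coeff, coeff_X_pow]

/-- Support of a high-digit factor. [folklore] -/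
theorem support_highDigits_subset (q r : ℕ) :
    (∑ b ∈ Finset.range r, (X : Polynomial ℂ) ^ (q * b)).support ⊆ (Finset.range r).image (fun b => q * b) := by
  intro n hn
  rw [mem_support_iff, coeff_highDigits] at hn
  by_contra h
  apply hn
  refine Finset.sum_eq_zero fun b hb => ?_
  rw [if_neg]
  rintro rfl
  exact h (Finset.mem_image.2 ⟨b, hb, rfl⟩)

/-- A high-digit factor `∑_{b<r} X^{qb}` is `r`-sparse. [folklore] -/
theorem card_support_highDigits_le (q r : ℕ) :
    (∑ b ∈ Finset.range r, (X : Polynomial ℂ) ^ (q * b)).support.card ≤ r :=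
  (Finset.card_le_card (support_highDigits_subset q r)).trans (Finset.card_image_le.trans (by simp))

/-- Degree of the low-digit factor. [folklore] -/
theorem natDegree_lowDigits_le (q : ℕ) : (∑ a ∈ Finset.Ico 1 q, (X : Polynomial ℂ) ^ a).natDegree ≤ q := by
  refine natDegree_sum_le_of_forall_le _ _ fun a ha => ?_
  rw [natDegree_X_pow]
  exact (Finset.mem_Ico.1 ha).2.le

/-- Degree of the high-digit factor. [folklore] -/
theorem natDegree_highDigits_le (q : ℕ) :
    (∑ b ∈ Finset.range q, (X : Polynomial ℂ) ^ (q * b)).natDegree ≤ q * q := by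
  refine natDegree_sum_le_of_forall_le _ _ fun b hb => ?_
  rw [natDegree_X_pow]
  exact Nat.mul_le_mul_left q (Finset.mem_range.1 hb).le

/-! ### Jacobi symbols at prime powers -/

/-- The Jacobi symbol modulo a prime square is the principal character: `(m | q²) = [q ∤ m]`.
[folklore] -/
theorem jacobiSym_prime_sq (q : ℕ) [Fact q.Prime] (m : ℕ) :
    jacobiSym m (q ^ 2) = if q ∣ m then 0 else 1 := by
  have hcast : (((m : ℤ) : ZMod q) = 0) ↔ q ∣ m := by
    rw [ZMod.intCast_zmod_eq_zero_iff_dvd, Int.natCast_dvd_natCast]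
  rw [jacobiSym.pow_right, ← jacobiSym.legendreSym.to_jacobiSym]
  split_ifs with h
  · rw [(legendreSym.eq_zero_iff q (m : ℤ)).2 (hcast.2 h), zero_pow two_ne_zero]
  · exact legendreSym.sq_one q (fun h0 => h (hcast.1 h0))

/-- `(m | n³) = (m | n)` for the Jacobi symbol. [folklore] -/
theorem jacobiSym_cube (m n : ℕ) : jacobiSym m (n ^ 3) = jacobiSym m n := by
  rw [jacobiSym.pow_right]
  rcases jacobiSym.trichotomy (m : ℤ) n with h | h | h <;> rw [h] <;> norm_num

/-! ### Digit splittings of Jacobi–Fekete polynomials at prime powers -/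

/-- **Digit splitting at a prime square.** `∑_{m<q²} (m|q²) X^m = (∑_{1≤a<q} X^a)·(∑_{b<q} X^{qb})`:
the Jacobi–Fekete polynomial of a prime-square modulus is a product of two `q`-sparse polynomials.
[folklore] -/
theorem prime_sq_digit_split (q : ℕ) [Fact q.Prime] :
    (∑ a ∈ Finset.Ico 1 q, (X : Polynomial ℂ) ^ a) * (∑ b ∈ Finset.range q, (X : Polynomial ℂ) ^ (q * b)) =
      ∑ m ∈ Finset.range (q ^ 2), C ((jacobiSym m (q ^ 2) : ℤ) : ℂ) * X ^ m := by
  have hq : 0 < q := (Fact.out : q.Prime).pos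
  rw [Finset.sum_mul_sum, ← Finset.sum_product']
  have hR : (∑ m ∈ Finset.range (q ^ 2), C ((jacobiSym m (q ^ 2) : ℤ) : ℂ) * X ^ m)
      = ∑ m ∈ (Finset.range (q ^ 2)).filter (fun m => ¬ q ∣ m), (X : Polynomial ℂ) ^ m := by
    rw [Finset.sum_filter]
    refine Finset.sum_congr rfl fun m _ => ?_
    rw [jacobiSym_prime_sq]
    split_ifs with h <;> simp
  rw [hR]
  refine Finset.sum_nbij' (fun x => x.1 + q * x.2) (fun m => (m % q, m / q)) ?_ ?_ ?_ ?_ ?_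
  · rintro ⟨a, b⟩ hab
    simp only [Finset.mem_product, Finset.mem_Ico, Finset.mem_range] at hab
    obtain ⟨⟨ha1, haq⟩, hb⟩ := hab
    simp only [Finset.mem_filter, Finset.mem_range]
    refine ⟨?_, ?_⟩
    · have key : q * b + q ≤ q * q := by rw [← Nat.mul_succ]; exact Nat.mul_le_mul_left q hb
      rw [sq]
      omega
    · intro hdvd
      have hqa : q ∣ a := (Nat.dvd_add_left (dvd_mul_right q b)).1 hdvd
      exact absurd (Nat.le_of_dvd (by omega) hqa) (by omega)
  · intro m hm
    simp only [Finset.mem_filter, Finset.mem_range] at hm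
    obtain ⟨hm, hndvd⟩ := hm
    simp only [Finset.mem_product, Finset.mem_Ico, Finset.mem_range]
    refine ⟨⟨?_, Nat.mod_lt _ hq⟩, ?_⟩
    · rcases Nat.eq_zero_or_pos (m % q) with h0 | hpos
      · exact absurd (Nat.dvd_of_mod_eq_zero h0) hndvd
      · exact hpos
    · exact (Nat.div_lt_iff_lt_mul hq).2 (by rw [sq] at hm; exact hm)
  · rintro ⟨a, b⟩ hab
    simp only [Finset.mem_product, Finset.mem_Ico, Finset.mem_range] at hab
    obtain ⟨⟨_, haq⟩, _⟩ := hab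
    show ((a + q * b) % q, (a + q * b) / q) = (a, b)
    rw [Nat.add_mul_mod_self_left, Nat.mod_eq_of_lt haq, Nat.add_mul_div_left _ _ hq,
      Nat.div_eq_of_lt haq, zero_add]
  · intro m _
    exact Nat.mod_add_div m q
  · rintro ⟨a, b⟩ _
    exact (pow_add _ _ _).symm

/-- **Digit splitting at a prime cube (non-principal character).**
`∑_{m<q³} (m|q³) X^m = F_q(X) · ∑_{j<q²} X^{qj}`: the Jacobi–Fekete polynomial of the imprimitive
character `(· | q)` to the modulus `q³` is the product of the `(q−1)`-sparse `F_q` and a `q²`-sparse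
polynomial — support-sum `O(n^{2/3})` for the odd modulus `n = q³`. [folklore] -/
theorem prime_cube_digit_split (q : ℕ) [Fact q.Prime] :
    (∑ m ∈ Finset.range q, C ((legendreSym q m : ℤ) : ℂ) * X ^ m) *
        (∑ j ∈ Finset.range (q ^ 2), (X : Polynomial ℂ) ^ (q * j)) =
      ∑ m ∈ Finset.range (q ^ 3), C ((jacobiSym m (q ^ 3) : ℤ) : ℂ) * X ^ m := by
  have hq : 0 < q := (Fact.out : q.Prime).pos
  rw [Finset.sum_mul_sum, ← Finset.sum_product']
  refine Finset.sum_nbij' (fun x => x.1 + q * x.2) (fun m => (m % q, m / q)) ?_ ?_ ?_ ?_ ?_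
  · rintro ⟨a, j⟩ h
    simp only [Finset.mem_product, Finset.mem_range] at h ⊢
    have key : q * j + q ≤ q * q ^ 2 := by rw [← Nat.mul_succ]; exact Nat.mul_le_mul_left q h.2
    have h3 : q ^ 3 = q * q ^ 2 := by ring
    omega
  · intro m hm
    simp only [Finset.mem_range, Finset.mem_product] at hm ⊢
    refine ⟨Nat.mod_lt _ hq, (Nat.div_lt_iff_lt_mul hq).2 ?_⟩
    calc m < q ^ 3 := hm
      _ = q ^ 2 * q := by ring
  · rintro ⟨a, j⟩ h
    simp only [Finset.mem_product, Finset.mem_range] at h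
    show ((a + q * j) % q, (a + q * j) / q) = (a, j)
    rw [Nat.add_mul_mod_self_left, Nat.mod_eq_of_lt h.1, Nat.add_mul_div_left _ _ hq,
      Nat.div_eq_of_lt h.1, zero_add]
  · intro m _
    exact Nat.mod_add_div m q
  · rintro ⟨a, j⟩ h
    simp only [Finset.mem_product, Finset.mem_range] at h
    have hJ : jacobiSym ((a + q * j : ℕ) : ℤ) (q ^ 3) = legendreSym q a := by
      rw [jacobiSym_cube, jacobiSym.mod_left, jacobiSym.legendreSym.to_jacobiSym]
      congr 1
      push_cast
      rw [Int.add_mul_emod_self_left]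
      exact Int.emod_eq_of_lt (by positivity) (by exact_mod_cast h.1)
    show C ((legendreSym q (a : ℕ) : ℤ) : ℂ) * X ^ a * X ^ (q * j)
      = C ((jacobiSym ((a + q * j : ℕ) : ℤ) (q ^ 3) : ℤ) : ℂ) * X ^ (a + q * j)
    rw [hJ, pow_add, mul_assoc]

/-! ### The odd-modulus version of X is false -/

/-- **It IS a strengthening**: the δ-slice of X over odd moduli (Jacobi symbol) implies the δ-slice of X
over primes (Legendre symbol), by restricting to primes `≥ 3`. [folklore] -/
theorem jacobi_slice_to_legendre_slice {δ : ℝ}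
    (h : ∃ p₀ : ℕ, ∀ p : ℕ, Odd p → p₀ ≤ p → ∀ (s : ℕ) (c : Fin s → ℂ) (g : Fin s → Polynomial ℂ),
      (s : ℝ) ≤ (p : ℝ) ^ δ → (∀ i, (g i).natDegree ≤ p ^ 2) →
      (∑ i, C (c i) * g i ^ 2) = ∑ m ∈ Finset.range p, C ((jacobiSym m p : ℤ) : ℂ) * X ^ m →
      (p : ℝ) ^ (1 / 2 + δ) ≤ ∑ i, ((g i).support.card : ℝ)) :
    ∃ p₀ : ℕ, ∀ (p : ℕ) [Fact p.Prime], p₀ ≤ p → ∀ (s : ℕ) (c : Fin s → ℂ) (g : Fin s → Polynomial ℂ),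
      (s : ℝ) ≤ (p : ℝ) ^ δ → (∀ i, (g i).natDegree ≤ p ^ 2) →
      (∑ i, C (c i) * g i ^ 2) = ∑ m ∈ Finset.range p, C ((legendreSym p m : ℤ) : ℂ) * X ^ m →
      (p : ℝ) ^ (1 / 2 + δ) ≤ ∑ i, ((g i).support.card : ℝ) := by
  obtain ⟨p₀, H⟩ := h
  refine ⟨max p₀ 3, fun p _ hp s c g hs hdeg hrep => ?_⟩
  have hprime : p.Prime := Fact.out
  have hp3 : 3 ≤ p := le_trans (le_max_right _ _) hp
  have hodd : Odd p := hprime.odd_of_ne_two (by omega)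
  refine H p hodd (le_trans (le_max_left _ _) hp) s c g hs hdeg (hrep.trans ?_)
  refine Finset.sum_congr rfl fun m _ => ?_
  rw [jacobiSym.legendreSym.to_jacobiSym]

/-- **X without primality is false at EVERY δ > 0.** For a large prime `q` the odd modulus `p = q²`
admits the two-square representation `F_{q²} = ¼(A+B)² − ¼(A−B)²` (`A, B` the digit factors of
`prime_sq_digit_split`): `s = 2 ≤ p^δ`, degrees `≤ q² ≤ p²`, support-sum `≤ 4q − 2 < q^{1+2δ} = p^{1/2+δ}`.
[folklore] -/
theorem feketeSOSHard_slice_false_without_prime {δ : ℝ} (hδ : 0 < δ) :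
    ¬ (∃ p₀ : ℕ, ∀ p : ℕ, Odd p → p₀ ≤ p → ∀ (s : ℕ) (c : Fin s → ℂ) (g : Fin s → Polynomial ℂ),
      (s : ℝ) ≤ (p : ℝ) ^ δ → (∀ i, (g i).natDegree ≤ p ^ 2) →
      (∑ i, C (c i) * g i ^ 2) = ∑ m ∈ Finset.range p, C ((jacobiSym m p : ℤ) : ℂ) * X ^ m →
      (p : ℝ) ^ (1 / 2 + δ) ≤ ∑ i, ((g i).support.card : ℝ)) := by
  rintro ⟨p₀, H⟩
  set N : ℕ := ⌈(4 : ℝ) ^ (1 / (2 * δ))⌉₊ + 1 with hN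
  obtain ⟨q, hq_ge, hq_prime⟩ := Nat.exists_infinite_primes (max p₀ (max 3 N))
  haveI : Fact q.Prime := ⟨hq_prime⟩
  have hp₀q : p₀ ≤ q := le_trans (le_max_left _ _) hq_ge
  have h3 : 3 ≤ q := le_trans (le_trans (le_max_left _ _) (le_max_right _ _)) hq_ge
  have hNq : N ≤ q := le_trans (le_trans (le_max_right _ _) (le_max_right _ _)) hq_ge
  have hq_pos : (0 : ℝ) < q := by exact_mod_cast hq_prime.pos
  have hodd : Odd (q ^ 2) := (hq_prime.odd_of_ne_two (by omega)).pow
  have hp₀' : p₀ ≤ q ^ 2 := hp₀q.trans (Nat.le_self_pow two_ne_zero q)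
  have h2δ : 0 < 2 * δ := by linarith
  -- numerics: 4 < q^{2δ}
  have hgt : (4 : ℝ) < (q : ℝ) ^ (2 * δ) := by
    have hNreal : (4 : ℝ) ^ (1 / (2 * δ)) < (q : ℝ) := by
      have h1 : (4 : ℝ) ^ (1 / (2 * δ)) ≤ (⌈(4 : ℝ) ^ (1 / (2 * δ))⌉₊ : ℝ) := Nat.le_ceil _
      have h2 : ((⌈(4 : ℝ) ^ (1 / (2 * δ))⌉₊ : ℕ) : ℝ) + 1 ≤ (q : ℝ) := by exact_mod_cast hNq
      linarith
    calc (4 : ℝ) = ((4 : ℝ) ^ (1 / (2 * δ))) ^ (2 * δ) := by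
          rw [← Real.rpow_mul (by norm_num : (0 : ℝ) ≤ 4), one_div, inv_mul_cancel₀ h2δ.ne',
            Real.rpow_one]
      _ < (q : ℝ) ^ (2 * δ) := Real.rpow_lt_rpow (by positivity) hNreal h2δ
  have hcast : ((q ^ 2 : ℕ) : ℝ) = (q : ℝ) ^ (2 : ℝ) := by
    rw [Real.rpow_two]; push_cast; ring
  -- (1) two squares are admitted: 2 ≤ (q²)^δ = q^{2δ}
  have hs : ((2 : ℕ) : ℝ) ≤ ((q ^ 2 : ℕ) : ℝ) ^ δ := by
    rw [hcast, ← Real.rpow_mul hq_pos.le]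
    push_cast
    linarith
  -- the representation
  set A : Polynomial ℂ := ∑ a ∈ Finset.Ico 1 q, (X : Polynomial ℂ) ^ a with hA
  set B : Polynomial ℂ := ∑ b ∈ Finset.range q, (X : Polynomial ℂ) ^ (q * b) with hB
  have hrep : (∑ i, C ((![(4 : ℂ)⁻¹, -(4 : ℂ)⁻¹]) i) * (![A + B, A - B]) i ^ 2)
      = ∑ m ∈ Finset.range (q ^ 2), C ((jacobiSym m (q ^ 2) : ℤ) : ℂ) * X ^ m := by
    simp only [Fin.sum_univ_two, Matrix.cons_val_zero, Matrix.cons_val_one]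
    have h4 : (C (4 : ℂ)⁻¹ : Polynomial ℂ) * 4 = 1 := by
      rw [← map_ofNat C 4, ← C_mul, inv_mul_cancel₀ (by norm_num), C_1]
    rw [← prime_sq_digit_split q]
    have : C (4 : ℂ)⁻¹ * (A + B) ^ 2 + C (-(4 : ℂ)⁻¹) * (A - B) ^ 2 = C (4 : ℂ)⁻¹ * 4 * (A * B) := by
      rw [map_neg]; ring
    rw [this, h4, one_mul]
  have hdeg : ∀ i : Fin 2, ((![A + B, A - B]) i).natDegree ≤ (q ^ 2) ^ 2 := by
    have hA' : A.natDegree ≤ q := natDegree_lowDigits_le q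
    have hB' : B.natDegree ≤ q * q := natDegree_highDigits_le q
    have hqq : q ≤ q * q := Nat.le_mul_self q
    have hbig : q * q ≤ (q ^ 2) ^ 2 := by rw [← sq]; exact Nat.le_self_pow two_ne_zero _
    have h₁ : (A + B).natDegree ≤ (q ^ 2) ^ 2 :=
      (natDegree_add_le _ _).trans (max_le (hA'.trans (hqq.trans hbig)) (hB'.trans hbig))
    have h₂ : (A - B).natDegree ≤ (q ^ 2) ^ 2 :=
      (natDegree_sub_le _ _).trans (max_le (hA'.trans (hqq.trans hbig)) (hB'.trans hbig))
    intro i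
    fin_cases i
    · exact h₁
    · exact h₂
  have key := H (q ^ 2) hodd hp₀' 2 (![(4 : ℂ)⁻¹, -(4 : ℂ)⁻¹]) (![A + B, A - B]) hs hdeg hrep
  -- (2) support-sum ≤ 4q − 2
  have h1q : 1 ≤ q := hq_prime.one_lt.le
  have hcardA : (A.support.card : ℝ) ≤ q - 1 := by
    have h : (A.support.card : ℝ) ≤ ((q - 1 : ℕ) : ℝ) := by exact_mod_cast card_support_lowDigits_le q
    rwa [Nat.cast_sub h1q, Nat.cast_one] at h
  have hcardB : (B.support.card : ℝ) ≤ q := by exact_mod_cast card_support_highDigits_le q q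
  have hAB₁ : (((A + B).support.card : ℕ) : ℝ) ≤ A.support.card + B.support.card := by
    exact_mod_cast (Finset.card_le_card support_add).trans (Finset.card_union_le _ _)
  have hAB₂ : (((A - B).support.card : ℕ) : ℝ) ≤ A.support.card + B.support.card := by
    have hsub : (A - B).support ⊆ A.support ∪ B.support := by
      rw [sub_eq_add_neg]
      refine support_add.trans ?_
      rw [support_neg]
    exact_mod_cast (Finset.card_le_card hsub).trans (Finset.card_union_le _ _)
  have hsum : (∑ i : Fin 2, ((((![A + B, A - B]) i).support.card : ℝ))) ≤ 4 * q - 2 := by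
    simp only [Fin.sum_univ_two, Matrix.cons_val_zero, Matrix.cons_val_one]
    linarith
  -- (3) 4q − 2 < (q²)^{1/2+δ} = q · q^{2δ}
  have hlt : (4 : ℝ) * q < ((q ^ 2 : ℕ) : ℝ) ^ (1 / 2 + δ) := by
    rw [hcast, ← Real.rpow_mul hq_pos.le,
      show (2 : ℝ) * (1 / 2 + δ) = 1 + 2 * δ by ring, Real.rpow_add hq_pos, Real.rpow_one]
    calc (4 : ℝ) * q = q * 4 := by ring
      _ < q * (q : ℝ) ^ (2 * δ) := mul_lt_mul_of_pos_left hgt hq_pos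
  linarith

/-- **X without primality is false.** The statement of `FeketeSOSHard` with "`p` prime" weakened to
"`p` odd" (Legendre symbol read as Jacobi symbol) fails: the prime-square moduli are SOS-easy.
[folklore] -/
theorem feketeSOSHard_false_without_prime :
    ¬ (∃ δ : ℝ, 0 < δ ∧ ∃ p₀ : ℕ, ∀ p : ℕ, Odd p → p₀ ≤ p →
      ∀ (s : ℕ) (c : Fin s → ℂ) (g : Fin s → Polynomial ℂ),
      (s : ℝ) ≤ (p : ℝ) ^ δ → (∀ i, (g i).natDegree ≤ p ^ 2) →
      (∑ i, C (c i) * g i ^ 2) = ∑ m ∈ Finset.range p, C ((jacobiSym m p : ℤ) : ℂ) * X ^ m →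
      (p : ℝ) ^ (1 / 2 + δ) ≤ ∑ i, ((g i).support.card : ℝ)) :=
  fun ⟨_, hδ, h⟩ => feketeSOSHard_slice_false_without_prime hδ h

end Summit.ValiantsHypothesis.ValiantsHypothesis.Theorems.SOSMagnification.Negative
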